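import Mathlib
import HarnessLib

/-!
# Crux `ContinuumLegGivenGap` (stmt-QuantumFields-15828), line `duality-selection-nlo-skewness`: `SO(d)` is transitive on spheres for `d ≥ 2`

Registered stub `stub_rotationToAxis` of the line (lead `prover-line-stmt-QuantumFields-15828-c15-0`,
2026-08-17). The line proves Källén–Lehmann positivity of the truncated OS two-point function on the
Euclidean side; the OS axiom E1 (`LabelledSchwingerFamily.IsEuclideanInvariant`) gives invariance of the
Schwinger functions only under PROPER rotations `R : E ≃ₗᵢ[ℝ] E`, `det R = 1`, of
`E = EuclideanSpace ℝ (Fin d)`. To compare the two-point value of a pair of radial bumps centred at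
`(a, b)` with that of the axis pair one needs `SO(d)` to act transitively on every sphere `‖x‖ = r`
once `d ≥ 2`. This file is that pure linear-algebra fact (it is consumed as an explicit hypothesis
by `stub_bumpPairPositivity` and by the lead's assembly).

Proof. If `u = v` take the identity. Otherwise `v ≠ 0` (else `‖u‖ = 0` and `u = v`); the hyperplane
reflection `R₁` in `(ℝ ∙ (u - v))ᗮ` maps `u ↦ v` (Mathlib `Submodule.reflection_sub`) and has
determinant `-1` (`Submodule.det_reflection`, `det_reflection_orthogonal_span_singleton`); since
`finrank (ℝ ∙ v)ᗮ = d - 1 ≥ 1` there is a nonzero `w ⊥ v`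
(`exists_ne_zero_mem_orthogonal_span_singleton`), and the hyperplane reflection `R₂` in `(ℝ ∙ w)ᗮ`
fixes `v ∈ (ℝ ∙ w)ᗮ` (`Submodule.reflection_mem_subspace_eq_self`) and has determinant `-1`. Then
`R := R₂ ∘ R₁` has `det R = (-1)² = 1` and `R u = v`. (Same two-reflection argument as
`Literature.MathematicalPhysics.QuantumFieldTheory.exists_det_eq_one_map_eq_smul_single`, which only
rotates onto `±‖v‖ e₀`, and as `Literature.Barriers.QuantumFields.HaagTheoremProofs`, whose two
determinant lemmas are re-proved here to keep the imports at `Mathlib`.)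
-/

noncomputable section

namespace Summit.QuantumFields.YangMills.Cruxes.ContinuumLegGivenGap.DualitySelectionNloSkewness

open Module

/-- The reflection in the hyperplane `(ℝ ∙ w)ᗮ`, `w ≠ 0`, has determinant `-1`. [folklore] -/
theorem det_reflection_orthogonal_span_singleton {F : Type*} [NormedAddCommGroup F]
    [InnerProductSpace ℝ F] [FiniteDimensional ℝ F] {w : F} (hw : w ≠ 0) :
    LinearMap.det (((ℝ ∙ w)ᗮ.reflection).toLinearEquiv : F →ₗ[ℝ] F) = -1 := by
  -- adapted from `Literature.Barriers.QuantumFields.HaagTheoremProofs.det_reflection_orthogonal_singleton`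
  have h := ((ℝ ∙ w)ᗮ).det_reflection
  rw [Submodule.orthogonal_orthogonal, finrank_span_singleton hw, pow_one] at h
  exact h

/-- The determinant of a composite of linear isometric automorphisms is the product of the
determinants. [folklore] -/
theorem det_toLinearEquiv_trans {F : Type*} [NormedAddCommGroup F] [InnerProductSpace ℝ F]
    (A B : F ≃ₗᵢ[ℝ] F) :
    LinearMap.det ((A.trans B).toLinearEquiv : F →ₗ[ℝ] F) =
      LinearMap.det (B.toLinearEquiv : F →ₗ[ℝ] F) *
        LinearMap.det (A.toLinearEquiv : F →ₗ[ℝ] F) := by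
  -- adapted from `Literature.Barriers.QuantumFields.HaagTheoremProofs.det_toLinearEquiv_mul`
  rw [← LinearMap.det_comp]
  rfl

/-- In dimension `d ≥ 2` every nonzero vector of `ℝᵈ` admits a nonzero vector orthogonal to it:
`finrank (ℝ ∙ v)ᗮ = d - 1 ≥ 1`. [folklore] -/
theorem exists_ne_zero_mem_orthogonal_span_singleton {d : ℕ} (hd : 2 ≤ d)
    {v : EuclideanSpace ℝ (Fin d)} (hv : v ≠ 0) :
    ∃ w ∈ (ℝ ∙ v)ᗮ, w ≠ 0 := by
  apply Submodule.exists_mem_ne_zero_of_ne_bot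
  intro hbot
  have h1 := Submodule.finrank_add_finrank_orthogonal (𝕜 := ℝ) (ℝ ∙ v)
  rw [hbot, finrank_bot, finrank_span_singleton hv, finrank_euclideanSpace_fin] at h1
  omega

/-- **Registered stub `stub_rotationToAxis`** (line `duality-selection-nlo-skewness`): for `d ≥ 2` the
proper rotation group `SO(d)` acts transitively on every sphere of `EuclideanSpace ℝ (Fin d)` — any two
vectors of equal norm are exchanged by a linear isometric automorphism of determinant `1` (the product
of the hyperplane reflection in `(u - v)ᗮ` with a hyperplane reflection fixing `v`). [folklore] -/
theorem stub_rotationToAxis :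
    (∀ (d : ℕ), 2 ≤ d → ∀ u v : EuclideanSpace ℝ (Fin d), ‖u‖ = ‖v‖ →
      ∃ R : EuclideanSpace ℝ (Fin d) ≃ₗᵢ[ℝ] EuclideanSpace ℝ (Fin d),
        LinearMap.det (R.toLinearEquiv : EuclideanSpace ℝ (Fin d) →ₗ[ℝ] EuclideanSpace ℝ (Fin d)) = 1 ∧ R u = v) := by
  intro d hd u v huv
  by_cases h : u = v
  · subst h
    refine ⟨LinearIsometryEquiv.refl ℝ _, ?_, rfl⟩
    change LinearMap.det (LinearMap.id : EuclideanSpace ℝ (Fin d) →ₗ[ℝ] EuclideanSpace ℝ (Fin d)) = 1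
    exact LinearMap.det_id
  · have hv : v ≠ 0 := by
      rintro rfl
      rw [norm_zero, norm_eq_zero] at huv
      exact h huv
    obtain ⟨w, hw, hw0⟩ := exists_ne_zero_mem_orthogonal_span_singleton hd hv
    refine ⟨((ℝ ∙ (u - v))ᗮ.reflection).trans ((ℝ ∙ w)ᗮ.reflection), ?_, ?_⟩
    · rw [det_toLinearEquiv_trans, det_reflection_orthogonal_span_singleton hw0,
        det_reflection_orthogonal_span_singleton (sub_ne_zero.2 h)]
      norm_num
    · rw [LinearIsometryEquiv.trans_apply, Submodule.reflection_sub huv]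
      exact Submodule.reflection_mem_subspace_eq_self
        (Submodule.mem_orthogonal_singleton_iff_inner_left.2
          (Submodule.mem_orthogonal_singleton_iff_inner_right.1 hw))

end Summit.QuantumFields.YangMills.Cruxes.ContinuumLegGivenGap.DualitySelectionNloSkewness

end
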